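import Summits.RiemannHypothesis.RiemannHypothesis.Theorems.SemilocalDeletionDipoleHalfRoom
import Summits.RiemannHypothesis.RiemannHypothesis.Theorems.SemilocalDeletionPairFloor
import HarnessLib

/-!
# The PAIR INTERACTION of two spread prime deletions is pinned by the orbit graph

Capstone of the deletion-cliff files (`SemilocalDeletionDipole`, `…HalfRoom`, `…SchurFloor`, `…PairFloor`).  For primes
`p₁ ≠ p₂` in `S`, visible as single atoms on `C(c)` (`(log p₂)/2 < c < log p₁ ≤ log p₂`) and SPREAD (`2c < 2 log p₂ − log p₁`),
with the UNDELETED form positive on `C(c)`, the inclusion–exclusion pair term of the bottoms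

  `I := λ_min(S∖{p₁,p₂}; c; σ) − λ_min(S∖{p₁}; c; σ) − λ_min(S∖{p₂}; c; σ) + λ_min(S; c; σ)`

obeys `I ≥ (w₁ + w₂ − ρ₄) − 2λ_min(S; δ₁; σ̄) − 2λ_min(S; δ₂; σ̄)` (`δᵢ = c − (log pᵢ)/2` the two half-rooms, `σ̄` the opposite
parity; also the all-sector version), where `w₁ + w₂ − ρ₄ > 0` is the gap between the SUM floor and the Perron root of the 4-path
(`pairInteraction_const_pos`).  Mechanism: the pair floor is `−ρ₄` (orbit graph) while each single deletion reaches its own cliff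
`−wᵢ` up to twice the window energy at its half-room.  So throughout the spread regime the interaction is bounded BELOW by
a positive constant of the lag geometry minus window energies — it is an orbit-graph effect, not a small-energy effect (the THEOREM
form, for this configuration class, of the cell's finding that prime-deletion interactions do not die out: DATA-CUT
item (2), PRED-CLIFF19-ORBIT PART O).  E.g. `{11, 23}` at `b = 9/5`: `w₁ + w₂ − ρ₄ = 1.37676 − 1.12033 = 0.25643`, while the
certified free-odd section bottoms (N = 200) give `I = −1.11254 + 0.72299 + 0.65225 + 0.00000 = +0.26270` (the bound reads
`≥ 0.25643 − 2ε_ev(0.601) − 2ε_ev(0.232) ≥ 0.25643 − 2·1.6e−9 − 2·0.0573 = 0.1418` with the certified section values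
`ε_ev,200(0.6) = 1.6e−9`, `ε_ev,200(0.2259) = 0.0573` as upper bounds of the two window energies).  Nothing here bears on RH.
-/

set_option linter.dupNamespace false

noncomputable section

open Complex Filter Set MeasureTheory
open scoped Real Topology ComplexConjugate

namespace Summit.RiemannHypothesis.RiemannHypothesis.Theorems.SemilocalDeletionPairInteraction

open Literature.NumberTheory.LFunctions
open Summit.RiemannHypothesis.RiemannHypothesis.Theorems.SemilocalDeletionCliff
open Summit.RiemannHypothesis.RiemannHypothesis.Theorems.SemilocalDeletionDipole
open Summit.RiemannHypothesis.RiemannHypothesis.Theorems.SemilocalDeletionDipoleHalfRoom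
open Summit.RiemannHypothesis.RiemannHypothesis.Theorems.SemilocalDeletionPairFloor
open Summit.RiemannHypothesis.RiemannHypothesis.Theorems.HandoffSemilocalEnergy

variable {S : Finset ℕ} {p₁ p₂ : ℕ} {c : ℝ}

/-- **THE PAIR INTERACTION IS PINNED BY THE ORBIT GEOMETRY (odd sector).** Let `p₁ ≠ p₂` be primes in `S`, visible and
single on the window (`(log p₂)/2 < c < log p₁ ≤ log p₂`) and SPREAD (`2c < 2 log p₂ − log p₁`), and let `Q_S ≥ 0` on `C(c)`.
Write `wᵢ = log pᵢ/√pᵢ`, `ρ₄ = (w₂ + √(w₂² + 4w₁²))/2`, `δᵢ = c − (log pᵢ)/2` (the two half-rooms).  Then the Möbius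
(inclusion–exclusion) pair term of the free-odd bottoms satisfies
`λ(S∖{p₁,p₂}) − λ(S∖{p₁}) − λ(S∖{p₂}) + λ(S) ≥ (w₁ + w₂ − ρ₄) − 2λ_min(S; δ₁; even) − 2λ_min(S; δ₂; even)`:
a POSITIVE structural constant (`perronFour_lt_add`) minus twice the even window energies at the two half-rooms.
(Pair floor `semilocalGroundEnergy_sdiff_pair_ge` + the two half-room ceilings `semilocalGroundEnergy_erase_odd_le` +
`λ(S) ≥ 0`.) -/
theorem pairInteraction_odd_ge (hp₁ : p₁.Prime) (hp₂ : p₂.Prime) (h1S : p₁ ∈ S) (h2S : p₂ ∈ S) (hne : p₁ ≠ p₂)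
    (hvis : Real.log p₂ / 2 < c) (hc1 : c < Real.log p₁) (h12 : Real.log p₁ ≤ Real.log p₂)
    (hstar : 2 * c < 2 * Real.log p₂ - Real.log p₁) (hpos : WeilSemilocalPositivityOn S c) :
    (Real.log p₁ / Real.sqrt p₁ + Real.log p₂ / Real.sqrt p₂ -
        (Real.log p₂ / Real.sqrt p₂ + Real.sqrt ((Real.log p₂ / Real.sqrt p₂) ^ 2 + 4 * (Real.log p₁ / Real.sqrt p₁) ^ 2)) / 2) -
      2 * semilocalGroundEnergy S (fun g ↦ ∀ t, g (-t) = g t) (c - Real.log p₁ / 2) -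
      2 * semilocalGroundEnergy S (fun g ↦ ∀ t, g (-t) = g t) (c - Real.log p₂ / 2) ≤
    semilocalGroundEnergy (S \ {p₁, p₂}) (fun g ↦ ∀ t, g (-t) = -g t) c -
      semilocalGroundEnergy (S.erase p₁) (fun g ↦ ∀ t, g (-t) = -g t) c -
      semilocalGroundEnergy (S.erase p₂) (fun g ↦ ∀ t, g (-t) = -g t) c +
      semilocalGroundEnergy S (fun g ↦ ∀ t, g (-t) = -g t) c := by
  -- the pair floor
  have hE := semilocalGroundEnergy_sdiff_pair_ge (P := fun g ↦ ∀ t, g (-t) = -g t) hp₁ hp₂ h1S h2S hne hc1 h12 hstar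
  -- the two single-prime half-room ceilings, windows written as (log pᵢ)/2 + δᵢ
  have hδ1 : 0 < c - Real.log p₁ / 2 := by linarith
  have hδ2 : 0 < c - Real.log p₂ / 2 := by linarith
  have h2δ1 : 2 * (c - Real.log p₁ / 2) < Real.log p₁ := by linarith
  have h2δ2 : 2 * (c - Real.log p₂ / 2) < Real.log p₂ := by linarith
  have e1 : Real.log p₁ / 2 + (c - Real.log p₁ / 2) = c := by ring
  have e2 : Real.log p₂ / 2 + (c - Real.log p₂ / 2) = c := by ring
  have hB1 := semilocalGroundEnergy_erase_odd_le (S := S) hp₁ h1S hδ1 h2δ1 (by rw [e1]; exact hpos)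
  have hB2 := semilocalGroundEnergy_erase_odd_le (S := S) hp₂ h2S hδ2 h2δ2 (by rw [e2]; exact hpos)
  rw [e1] at hB1
  rw [e2] at hB2
  -- positivity of the undeleted odd bottom
  have h0 : 0 ≤ semilocalGroundEnergy S (fun g ↦ ∀ t, g (-t) = -g t) c :=
    (semilocalGroundEnergy_nonneg_iff (S := S) (a := c) (P := fun g ↦ ∀ t, g (-t) = -g t)
      (fun a g _ hg t ↦ by simp only [hg t, mul_neg])).2 fun g hg hs _ ↦ hpos g hg hs
  linarith

/-- The same for the EVEN sector, floored by the ODD window energies at the two half-rooms. -/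
theorem pairInteraction_even_ge (hp₁ : p₁.Prime) (hp₂ : p₂.Prime) (h1S : p₁ ∈ S) (h2S : p₂ ∈ S) (hne : p₁ ≠ p₂)
    (hvis : Real.log p₂ / 2 < c) (hc1 : c < Real.log p₁) (h12 : Real.log p₁ ≤ Real.log p₂)
    (hstar : 2 * c < 2 * Real.log p₂ - Real.log p₁) (hpos : WeilSemilocalPositivityOn S c) :
    (Real.log p₁ / Real.sqrt p₁ + Real.log p₂ / Real.sqrt p₂ -
        (Real.log p₂ / Real.sqrt p₂ + Real.sqrt ((Real.log p₂ / Real.sqrt p₂) ^ 2 + 4 * (Real.log p₁ / Real.sqrt p₁) ^ 2)) / 2) -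
      2 * semilocalGroundEnergy S (fun g ↦ ∀ t, g (-t) = -g t) (c - Real.log p₁ / 2) -
      2 * semilocalGroundEnergy S (fun g ↦ ∀ t, g (-t) = -g t) (c - Real.log p₂ / 2) ≤
    semilocalGroundEnergy (S \ {p₁, p₂}) (fun g ↦ ∀ t, g (-t) = g t) c -
      semilocalGroundEnergy (S.erase p₁) (fun g ↦ ∀ t, g (-t) = g t) c -
      semilocalGroundEnergy (S.erase p₂) (fun g ↦ ∀ t, g (-t) = g t) c +
      semilocalGroundEnergy S (fun g ↦ ∀ t, g (-t) = g t) c := by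
  have hE := semilocalGroundEnergy_sdiff_pair_ge (P := fun g ↦ ∀ t, g (-t) = g t) hp₁ hp₂ h1S h2S hne hc1 h12 hstar
  have hδ1 : 0 < c - Real.log p₁ / 2 := by linarith
  have hδ2 : 0 < c - Real.log p₂ / 2 := by linarith
  have h2δ1 : 2 * (c - Real.log p₁ / 2) < Real.log p₁ := by linarith
  have h2δ2 : 2 * (c - Real.log p₂ / 2) < Real.log p₂ := by linarith
  have e1 : Real.log p₁ / 2 + (c - Real.log p₁ / 2) = c := by ring
  have e2 : Real.log p₂ / 2 + (c - Real.log p₂ / 2) = c := by ring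
  have hB1 := semilocalGroundEnergy_erase_even_le (S := S) hp₁ h1S hδ1 h2δ1 (by rw [e1]; exact hpos)
  have hB2 := semilocalGroundEnergy_erase_even_le (S := S) hp₂ h2S hδ2 h2δ2 (by rw [e2]; exact hpos)
  rw [e1] at hB1
  rw [e2] at hB2
  have h0 : 0 ≤ semilocalGroundEnergy S (fun g ↦ ∀ t, g (-t) = g t) c :=
    (semilocalGroundEnergy_nonneg_iff (S := S) (a := c) (P := fun g ↦ ∀ t, g (-t) = g t)
      (fun a g _ hg t ↦ by simp only [hg t])).2 fun g hg hs _ ↦ hpos g hg hs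
  linarith

/-- All sectors: `λ(S∖{p₁,p₂}) − λ(S∖{p₁}) − λ(S∖{p₂}) + λ(S) ≥ (w₁ + w₂ − ρ₄) − 2λ_min(S; δ₁) − 2λ_min(S; δ₂)`. -/
theorem pairInteraction_top_ge (hp₁ : p₁.Prime) (hp₂ : p₂.Prime) (h1S : p₁ ∈ S) (h2S : p₂ ∈ S) (hne : p₁ ≠ p₂)
    (hvis : Real.log p₂ / 2 < c) (hc1 : c < Real.log p₁) (h12 : Real.log p₁ ≤ Real.log p₂)
    (hstar : 2 * c < 2 * Real.log p₂ - Real.log p₁) (hpos : WeilSemilocalPositivityOn S c) :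
    (Real.log p₁ / Real.sqrt p₁ + Real.log p₂ / Real.sqrt p₂ -
        (Real.log p₂ / Real.sqrt p₂ + Real.sqrt ((Real.log p₂ / Real.sqrt p₂) ^ 2 + 4 * (Real.log p₁ / Real.sqrt p₁) ^ 2)) / 2) -
      2 * semilocalGroundEnergy S (fun _ ↦ True) (c - Real.log p₁ / 2) -
      2 * semilocalGroundEnergy S (fun _ ↦ True) (c - Real.log p₂ / 2) ≤
    semilocalGroundEnergy (S \ {p₁, p₂}) (fun _ ↦ True) c -
      semilocalGroundEnergy (S.erase p₁) (fun _ ↦ True) c -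
      semilocalGroundEnergy (S.erase p₂) (fun _ ↦ True) c +
      semilocalGroundEnergy S (fun _ ↦ True) c := by
  have hE := semilocalGroundEnergy_sdiff_pair_ge (P := fun _ ↦ True) hp₁ hp₂ h1S h2S hne hc1 h12 hstar
  have hδ1 : 0 < c - Real.log p₁ / 2 := by linarith
  have hδ2 : 0 < c - Real.log p₂ / 2 := by linarith
  have h2δ1 : 2 * (c - Real.log p₁ / 2) < Real.log p₁ := by linarith
  have h2δ2 : 2 * (c - Real.log p₂ / 2) < Real.log p₂ := by linarith
  have e1 : Real.log p₁ / 2 + (c - Real.log p₁ / 2) = c := by ring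
  have e2 : Real.log p₂ / 2 + (c - Real.log p₂ / 2) = c := by ring
  have hB1 := semilocalGroundEnergy_erase_top_le (S := S) hp₁ h1S hδ1 h2δ1 (by rw [e1]; exact hpos)
  have hB2 := semilocalGroundEnergy_erase_top_le (S := S) hp₂ h2S hδ2 h2δ2 (by rw [e2]; exact hpos)
  rw [e1] at hB1
  rw [e2] at hB2
  have h0 : 0 ≤ semilocalGroundEnergy S (fun _ ↦ True) c :=
    (semilocalGroundEnergy_nonneg_iff (S := S) (a := c) (P := fun _ ↦ True)
      (fun _ _ _ _ ↦ trivial)).2 fun g hg hs _ ↦ hpos g hg hs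
  linarith

/-- **The structural constant is positive**: `0 < w₁ + w₂ − ρ₄` for primes `p₁, p₂` — so the pair interaction is STRICTLY
POSITIVE as soon as `2λ_min(S; δ₁; σ̄) + 2λ_min(S; δ₂; σ̄) < w₁ + w₂ − ρ₄` (roomy half-rooms): deletions of spread primes
interact through the orbit graph, not through the window energies, and the interaction does not decay with room. -/
theorem pairInteraction_const_pos (hp₁ : p₁.Prime) (hp₂ : p₂.Prime) :
    0 < Real.log p₁ / Real.sqrt p₁ + Real.log p₂ / Real.sqrt p₂ -
      (Real.log p₂ / Real.sqrt p₂ + Real.sqrt ((Real.log p₂ / Real.sqrt p₂) ^ 2 + 4 * (Real.log p₁ / Real.sqrt p₁) ^ 2)) / 2 := by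
  have hw₁ : 0 < Real.log p₁ / Real.sqrt p₁ :=
    div_pos (Real.log_pos (by exact_mod_cast hp₁.one_lt)) (Real.sqrt_pos.2 (by exact_mod_cast hp₁.pos))
  have hw₂ : 0 < Real.log p₂ / Real.sqrt p₂ :=
    div_pos (Real.log_pos (by exact_mod_cast hp₂.one_lt)) (Real.sqrt_pos.2 (by exact_mod_cast hp₂.pos))
  linarith [perronFour_lt_add hw₁ hw₂]

end Summit.RiemannHypothesis.RiemannHypothesis.Theorems.SemilocalDeletionPairInteraction

end
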